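import Literature.AnabelianGeometry.EtaleTheta.TemperedFrobenioidOfGaloisCoveringTateTower
import Literature.AnabelianGeometry.EtaleTheta.Discharge.Sec3Cor38OfGaloisCoveringConnected
import Literature.AnabelianGeometry.EtaleTheta.TemperedFrobenioidOfGaloisCoveringOneComponentWeak
import Literature.AnabelianGeometry.EtaleTheta.Discharge.Sec3Cor38iiSelfEquivalenceWeak
import Literature.AnabelianGeometry.EtaleTheta.Discharge.Sec3Cor38iiWeakOfRatSupport
import Literature.AnabelianGeometry.EtaleTheta.Discharge.Sec3Def36iOfGaloisCovering
import Literature.AnabelianGeometry.EtaleTheta.Discharge.Sec3HQToyGenuine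
import Literature.AnabelianGeometry.EtaleTheta.Discharge.Sec3Cor38iToyGenuine
import HarnessLib

/-!
# [EtTh] Corollary 3.8 (i) and (ii) AS TYPED hold OUTRIGHT for the tempered Frobenioid of EVERY rank-one point of the
# CONSTRUCTED Def. 3.3 (iii) data of the connected coverings — instantiated at the MODEL OF RECORD (the Tate tower) and
# at the one-component model

S. Mochizuki, *The étale theta function and its Frobenioid-theoretic manifestations*, Publ. RIMS **45** (2009),
Cor. 3.8 (i)/(ii), statement PDF p. 80, proof pp. 81–82 [cite: MochizukiEtTh2009, Cor 3.8 p.80]; Def. 3.3 (iii) p. 73,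
Rmk. 3.3.1 p. 73, Prop. 3.4 (i)/(ii) p. 74, Def. 3.6 (i)/(ii) pp. 76–77 (Rmk. 3.6.1 / Example 3.9: the case of a single point
of `D₀` — the `p`-adic Frobenioid of the base field, [FrdII] Ex. 1.1), Rmk. 3.6.3 p. 79; S. Mochizuki, *The geometry of
Frobenioids I* (2008), §0 p. 10, Thm. 5.2 (ii) p. 100 [cite: MochizukiFrdI2008, Thm. 5.2(ii) p.100].

abc-iut cell, layer L2, cone nodes `EtTh:Cor3.8(i)` / `EtTh:Cor3.8(ii)`, row «COR38(i)(ii)@TateTower», seat abc-iut-L2-d2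
(gen 5).  PROOF-ONLY (0 definitions) — the (i)/(ii) sibling of abc-iut-w6-d052's Cor. 3.8 (iii) knit at the connected
coverings (`Sec3Cor38iiiOfGaloisCoveringConnectedKnit.lean`, R365), over abc-iut-w6-d048's NV engine
`TemperedFrobenioid.ofRankOnePoint hZ P hpf R S` (`TemperedFrobenioidOfGaloisCoveringRankOnePoint.lean`, p444230): the Def. 3.6
(ii) tempered Frobenioid of monoid type `ℤ` over abc-iut-L6-t12's weak data of record
`ofRlfZWeak (DivisorMonoids.ofGaloisActionConnected A hZ) hpf` (abc-iut-w6-d058's CONSTRUCTED Def. 3.3 (iii) data of the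
connected coverings dominated by a universal combinatorial covering `Z_∞`, Galois group `G`) at a RANK-ONE POINT `P`
(`Φ₀(S₀) ≅ ℕ`, every log-divisor over `S₀` the divisor of a constant), base `D = {pt} ↦ S₀`, `Φ := im(Φ₀(S₀)^pf → Φ₀(S₀)^rlf)`.

THE CLOSERS are the `Λ`-generic weak node closers `Cor38Hyp.cor38_i_weak_of_coord` (abc-iut-w6-d039, p439433) and
`Cor38Hyp.cor38_ii_weak_of_coord` / `hull_selfEquivalence_weak_of_coord` (abc-iut-L1-t12, p441772), inputs per side `hF` ·
`hP34Λ` · `hNZ` · `hQ` · [`hFinv` — (ii) only].  §1 checks EVERY ONE at `ofRankOnePoint hZ P hpf R S`, for ALL `(Z, G, A, hZ, P)`: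

* `hF` := abc-iut-w6-d048's `isFrobenioid_ofRankOnePoint`; `hP34Λ` / `hFinv` for EVERY connected covering `Y` := this seat's
  `hP34Λ_ofGaloisActionConnected_weak` / `hFinv_ofGaloisActionConnected_weak` (`Sec3Cor38OfGaloisCoveringConnected.lean`: abc-iut-w6-d058's
  THEOREM `DivisorMonoids.prop34_ofGaloisActionConnected` and `GaloisAction.exists_inv_mem_fZero` through abc-iut-L6-t12's lemmas);
* `isZQMonoprime_primes_Φ₀_rankOnePoint` — (hZQ) at `S₀`: `Φ₀(S₀) ≅ ℕ` is `ℤ`-monoprime, hence so is every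
  `Φ₀(S₀)_𝔭` (abc-iut-w5-d130's `HQRatCoord.isZMonoprime_submonoid_primes`); `ratSupport_ofRankOnePoint` (hsat); hence
  **`hQ_ofRankOnePoint`** (abc-iut-L6-t12's `hQ_ofRlfZWeak_of_ratSupport`);
* **`exists_cnstFn_effective_ofRankOnePoint`** — `hNZ` CONSTRUCTED from the rank-one-point datum `P.hcnst`: the constant
  `b₁ ∈ F₀(S₀)` with `div₀(b₁) = [e⁻¹ 1]`, paired with the class of `ι(e⁻¹ 1) ∈ Φ`, lies in `F(pt)` and is non-trivial;

§2 runs the compositions for every pair of rank-one points `(P, P′)` of two such models (NO `Prop34Const` needed here):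
**`cor38_i_ofRankOnePoint (h) : Cor38_i IsFrobeniusSlim h`**, `preservesBaseFieldTheoretic_ofRankOnePoint` (slim one-object
base), **`cor38_ii_ofRankOnePoint (h) : Cor38_ii (Def. 4.5 (iv)) h`**, `cor38_ii_conclusion_ofRankOnePoint` (the base is
Div-slim, abc-iut-w6-d040's `Toy.isDivSlim45iv_discretePUnit`), `cor38_i_ii_ofRankOnePoint`.  §3 instantiates BY NAME:
**`TateTowerFrd.cor38_i_temperedFrobenioid` / `cor38_ii_temperedFrobenioid` (+ conclusions) at the MODEL OF RECORD**
`TateTowerFrd.temperedFrobenioid R S` (abc-iut-w6-d048, the Tate tower of abc-iut-w6-d058), and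
`OneCompFrd.cor38_i/ii_temperedFrobenioidWeak` at the one-component model — [EtTh] Cor. 3.8 (i) and (ii) AS TYPED fire with NO binder
beyond the standing-hypotheses structure `h` at the first NON-DEGENERATE constructed tempered Frobenioids of the cell (genuine `D₀` =
connected `ℤ`-sets / `G`-sets with Galois content; print's `p`-adic Frobenioid of the base field at the bottom of the tower).  The
conjunction with abc-iut-w6-d052's Cor. 3.8 (iii) knit at rank-one points (p447266, R365) and the hull / `∃` forms follow in a sequel.

HONEST LABEL: instantiation / consistency certificates over GENUINE vocabularies and CONSTRUCTED data; each witness lives over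
ONE point of `D₀` (`D` one object); refereed pre-IUT material; nothing here bears on [IUTchIII] Cor. 3.12; typed ≠ proved.
-/

noncomputable section

namespace Literature.AnabelianGeometry.EtaleTheta

open CategoryTheory Opposite Function Literature.AlgebraicGeometry.Frobenioids
  Literature.AnabelianGeometry.SemiGraphs LogDivisorModel LogDivisorModel.GaloisAction

namespace TemperedFrobenioid

section RankOne

variable {Z : LogDivisorModel.{0}} {G : Type} [Group G] {A : Z.GaloisAction G} (hZ : Z.CuspLaws) (P : RankOnePoint A)
  (hpf : ∀ Y : ((isConnectedGSet (G := G)).FullSubcategory)ᵒᵖ,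
    IsPerfFactorialCof ((DivisorMonoids.ofGaloisActionConnected A hZ).Φ₀.obj Y))
  (R S : ((Discrete PUnit.{1})ᵒᵖ ⥤ CommMonCat.{0}) → Prop)

/-! ## §1 The print-level inputs of the weak Cor. 3.8 (i)/(ii) closers at a rank-one point -/

/-- **(hZQ) at a rank-one point** — [EtTh] Rmk. 3.3.1: `Φ₀(S₀) ≅ ℕ` is `ℤ`-monoprime, hence every prime component
`Φ₀(S₀)_𝔭` is `ℤ`-monoprime (abc-iut-w5-d130's `HQRatCoord.isZMonoprime_submonoid_primes`). [cite: MochizukiEtTh2009, Rmk 3.3.1 p.73] -/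
theorem isZQMonoprime_primes_Φ₀_rankOnePoint
    (𝔭 : Primes ((DivisorMonoids.ofGaloisActionConnected A hZ).Φ₀.obj (op P.S₀))) :
    IsZMonoprime ↥𝔭.submonoid ∨ IsQMonoprime ↥𝔭.submonoid :=
  Or.inl (HQRatCoord.isZMonoprime_submonoid_primes ⟨⟨P.e⟩⟩ 𝔭)

/-- **(hsat) at a rank-one point**: every `x ∈ Φ(pt) = im(Φ₀(S₀)^pf → Φ₀(S₀)^rlf)` has a power in the image of `Φ₀(S₀)`
(`ι(c^{1/n})^n = ι(c)`). [cite: MochizukiEtTh2009, Def 3.6 p.76] -/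
theorem ratSupport_ofRankOnePoint (W : Discrete PUnit.{1}) :
    ∀ x ∈ (ofRankOnePoint hZ P hpf R S).Φ.carrier (op W),
      ∃ (N : ℕ+) (d : (DivisorMonoids.ofGaloisActionConnected A hZ).Φ₀.obj ((ofRankOnePoint hZ P hpf R S).baseOp (op W))),
        x ^ (N : ℕ) = (hpf ((ofRankOnePoint hZ P hpf R S).baseOp (op W))).weak.toRealification (Perfection.of _ d) := by
  rintro x ⟨a, rfl⟩
  obtain ⟨⟨c, n⟩, rfl⟩ := Perfection.mk_surjective a
  refine ⟨n, c, ?_⟩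
  change (hpf _).weak.toRealification (Perfection.mk c n) ^ (n : ℕ) = (hpf _).weak.toRealification (Perfection.of _ c)
  rw [← map_pow, Perfection.mk_pow_self]

/-- **`hQ` OUTRIGHT at a rank-one point**: every localized perfection `Φ(pt)^pf_𝔮` is `ℚ`-monoprime (abc-iut-L6-t12's
`hQ_ofRlfZWeak_of_ratSupport` with (hZQ), (hsat) CHECKED) — the binder `hQ` of row C38-L05 (GAP G-w4d084-3) is a THEOREM at
every rank-one point of the constructed data. [cite: MochizukiEtTh2009, Def 3.6 p.77] -/
theorem hQ_ofRankOnePoint (W : Discrete PUnit.{1})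
    (𝔮 : Primes (Perfection ((ofRankOnePoint hZ P hpf R S).divisorMonoid.obj (op W)))) :
    IsQMonoprime (PfAt ((ofRankOnePoint hZ P hpf R S).divisorMonoid.obj (op W)) 𝔮) :=
  (ofRankOnePoint hZ P hpf R S).hQ_ofRlfZWeak_of_ratSupport W (fun 𝔭 => isZQMonoprime_primes_Φ₀_rankOnePoint hZ P 𝔭)
    (ratSupport_ofRankOnePoint hZ P hpf R S W) 𝔮

/-- **`hNZ` — [EtTh] Def. 3.6 (ii)(b), bracketed sentence ("the image of `F(A) → (Φ^{bs-fld})^gp(A)` contains a nonzero element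
of `Φ^{bs-fld}(A)`") — CONSTRUCTED at a rank-one point**: by the rank-one datum `P.hcnst` the generator `e⁻¹ 1 ∈ Φ₀(S₀)` is the
divisor of a constant `b₁ ∈ F₀(S₀)`; the pair `(b₁, [ι(e⁻¹ 1)])` lies in `F(pt) = F₀^ℤ|_D ×_{(Φ^{ℝ-log})^gp} Φ^gp` and
`ι(e⁻¹ 1) ≠ 1`. [cite: MochizukiEtTh2009, Def 3.6 p.77] -/
theorem exists_cnstFn_effective_ofRankOnePoint (X : (Discrete PUnit.{1})ᵒᵖ) :
    ∃ u : ((RankOnePoint.T hZ hpf).BΛ.obj ((ofRankOnePoint hZ P hpf R S).baseOp X) : Type) ×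
        Algebra.GrothendieckGroup ((ofRankOnePoint hZ P hpf R S).Φ.carrier X),
      u ∈ (ofRankOnePoint hZ P hpf R S).cnstFn X ∧
        ∃ x : (ofRankOnePoint hZ P hpf R S).Φ.carrier X, x ≠ 1 ∧ u.2 = Algebra.GrothendieckGroup.of x := by
  obtain ⟨b, hb, hbm⟩ := P.hcnst (P.e.symm (Multiplicative.ofAdd 1))
  let x : (ofRankOnePoint hZ P hpf R S).Φ.carrier X :=
    ⟨(hpf (op P.S₀)).weak.toRealification (Perfection.of _ (P.e.symm (Multiplicative.ofAdd 1))), ⟨_, rfl⟩⟩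
  -- the pair `(b₁, [x])` lies in `B(pt)`: `div^ℤ(b₁) = ι^gp(div₀ b₁) = [ι(e⁻¹ 1)]` is the image of `[x]` in `(Φ^{ℝ-log})^gp`
  have hdiv : (RankOnePoint.T hZ hpf).divΛ (op P.S₀) b =
      Algebra.GrothendieckGroup.of ((hpf (op P.S₀)).weak.toRealification
        (Perfection.of _ (P.e.symm (Multiplicative.ofAdd 1)))) := by
    rw [RealifiedDivisorMonoids.ofRlfZWeak_divΛ_apply]
    change EtaleTheta.gpMap _ ((DivisorMonoids.ofGaloisActionConnected A hZ).div₀ (op P.S₀) b) = _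
    rw [show (DivisorMonoids.ofGaloisActionConnected A hZ).div₀ (op P.S₀) b = Algebra.GrothendieckGroup.of _ from hbm]
    exact EtaleTheta.gpMap_of _ _
  have hrat : ((b, Algebra.GrothendieckGroup.of x) :
      ((RankOnePoint.T hZ hpf).BΛ.obj ((ofRankOnePoint hZ P hpf R S).baseOp X) : Type) ×
        Algebra.GrothendieckGroup ((ofRankOnePoint hZ P hpf R S).Φ.carrier X)) ∈
      (ofRankOnePoint hZ P hpf R S).ratFn X := by
    change (RankOnePoint.T hZ hpf).divΛ (op P.S₀) b = (ofRankOnePoint hZ P hpf R S).ΦgpToRlog X (Algebra.GrothendieckGroup.of x)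
    rw [hdiv, TemperedFrobenioid.ΦgpToRlog, EtaleTheta.gpMap_of]
    rfl
  refine ⟨(b, Algebra.GrothendieckGroup.of x), Submonoid.mem_inf.2 ⟨hrat, hb⟩, x, fun h => ?_, rfl⟩
  exact P.toRealification_gen_ne_one hZ hpf (congrArg Subtype.val h)

end RankOne

/-! ## §2 Cor. 3.8 (i)/(ii) AS TYPED for every pair of rank-one points, with no binder beyond `h` -/

section RankOnePair

variable {Z : LogDivisorModel.{0}} {G : Type} [Group G] {A : Z.GaloisAction G} (hZ : Z.CuspLaws) (P : RankOnePoint A)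
  (hpf : ∀ Y : ((isConnectedGSet (G := G)).FullSubcategory)ᵒᵖ,
    IsPerfFactorialCof ((DivisorMonoids.ofGaloisActionConnected A hZ).Φ₀.obj Y))
  (R S : ((Discrete PUnit.{1})ᵒᵖ ⥤ CommMonCat.{0}) → Prop)
  {Z' : LogDivisorModel.{0}} {G' : Type} [Group G'] {A' : Z'.GaloisAction G'} (hZ' : Z'.CuspLaws)
  (P' : RankOnePoint A')
  (hpf' : ∀ Y : ((isConnectedGSet (G := G')).FullSubcategory)ᵒᵖ,
    IsPerfFactorialCof ((DivisorMonoids.ofGaloisActionConnected A' hZ').Φ₀.obj Y))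
  (R' S' : ((Discrete PUnit.{1})ᵒᵖ ⥤ CommMonCat.{0}) → Prop)

/-- **[EtTh] Cor. 3.8 (i) AS TYPED (vocabulary parameter := `IsFrobeniusSlim`) holds with NO hypothesis for EVERY Cor. 3.8
datum `h` between the tempered Frobenioids of two rank-one points of two constructed connected Def. 3.3 (iii) data** —
abc-iut-w6-d039's `Λ`-generic closer `Cor38Hyp.cor38_i_weak_of_coord` with `hF`, `hP34Λ`, `hNZ`, `hQ` per side THEOREMS (§1).
[cite: MochizukiEtTh2009, Cor 3.8 p.80] -/
theorem cor38_i_ofRankOnePoint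
    (h : Cor38Hyp (ofRankOnePoint hZ P hpf R S) (ofRankOnePoint hZ' P' hpf' R' S')) :
    Literature.AnabelianGeometry.EtaleTheta.Cor38_i
      (fun E _ => Literature.AlgebraicGeometry.Frobenioids.IsFrobeniusSlim E) h :=
  h.cor38_i_weak_of_coord (isFrobenioid_ofRankOnePoint hZ P hpf R S) (isFrobenioid_ofRankOnePoint hZ' P' hpf' R' S')
    (hP34Λ_ofGaloisActionConnected_weak A hZ hpf) (exists_cnstFn_effective_ofRankOnePoint hZ P hpf R S)
    (hQ_ofRankOnePoint hZ P hpf R S) (hP34Λ_ofGaloisActionConnected_weak A' hZ' hpf')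
    (exists_cnstFn_effective_ofRankOnePoint hZ' P' hpf' R' S') (hQ_ofRankOnePoint hZ' P' hpf' R' S')

/-- **The CONCLUSION of [EtTh] Cor. 3.8 (i) — "`Ψ` preserves the base-field-theoretic morphisms" — for every such `h`**: the
one-object base is slim (abc-iut-L1's `isSlim_discretePUnit`), hence Frobenius-slim. [cite: MochizukiEtTh2009, Cor 3.8 p.80] -/
theorem preservesBaseFieldTheoretic_ofRankOnePoint
    (h : Cor38Hyp (ofRankOnePoint hZ P hpf R S) (ofRankOnePoint hZ' P' hpf' R' S')) :
    Literature.AnabelianGeometry.EtaleTheta.PreservesBaseFieldTheoretic h :=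
  cor38_i_ofRankOnePoint hZ P hpf R S hZ' P' hpf' R' S' h isSlim_discretePUnit.isFrobeniusSlim
    isSlim_discretePUnit.isFrobeniusSlim

/-- **[EtTh] Cor. 3.8 (ii) AS TYPED (vocabulary parameter := [FrdI] Def. 4.5 (iv) "Div-slim") holds with NO hypothesis for
EVERY Cor. 3.8 datum `h` between the tempered Frobenioids of two rank-one points** — abc-iut-L1-t12's `Λ`-generic closer
`Cor38Hyp.cor38_ii_weak_of_coord` with `hF`, `hP34Λ`, `hNZ`, `hQ`, `hFinv` per side THEOREMS (§1).
[cite: MochizukiEtTh2009, Cor 3.8 p.81] -/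
theorem cor38_ii_ofRankOnePoint
    (h : Cor38Hyp (ofRankOnePoint hZ P hpf R S) (ofRankOnePoint hZ' P' hpf' R' S')) :
    Literature.AnabelianGeometry.EtaleTheta.Cor38_ii
      (fun E _ Φ => ∀ (A : E) (α : Aut (Over.forget A)),
        (∀ (B : Over A) (x : Φ.obj (op B.left)),
          Literature.AlgebraicGeometry.Frobenioids.pull Φ (α.hom.app B) x = x) → α = 1) h :=
  h.cor38_ii_weak_of_coord (isFrobenioid_ofRankOnePoint hZ P hpf R S) (isFrobenioid_ofRankOnePoint hZ' P' hpf' R' S')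
    (hP34Λ_ofGaloisActionConnected_weak A hZ hpf) (exists_cnstFn_effective_ofRankOnePoint hZ P hpf R S)
    (hQ_ofRankOnePoint hZ P hpf R S) (hFinv_ofGaloisActionConnected_weak A hZ hpf)
    (hP34Λ_ofGaloisActionConnected_weak A' hZ' hpf') (exists_cnstFn_effective_ofRankOnePoint hZ' P' hpf' R' S')
    (hQ_ofRankOnePoint hZ' P' hpf' R' S') (hFinv_ofGaloisActionConnected_weak A' hZ' hpf')

/-- **The CONCLUSION of [EtTh] Cor. 3.8 (ii) for every such `h`**: `Ψ` preserves the base-field-theoretic morphisms and induces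
a compatible equivalence of the base-field-theoretic hulls (the one-object base is Div-slim, abc-iut-w6-d040's
`Toy.isDivSlim45iv_discretePUnit`). [cite: MochizukiEtTh2009, Cor 3.8 p.81] -/
theorem cor38_ii_conclusion_ofRankOnePoint
    (h : Cor38Hyp (ofRankOnePoint hZ P hpf R S) (ofRankOnePoint hZ' P' hpf' R' S')) :
    PreservesBaseFieldTheoretic h ∧
      ∃ Ψbs : (ofRankOnePoint hZ P hpf R S).hullCategory ≌ (ofRankOnePoint hZ' P' hpf' R' S').hullCategory,
        Nonempty ((ofRankOnePoint hZ P hpf R S).hull ⋙ h.Ψ.functor ≅ Ψbs.functor ⋙ (ofRankOnePoint hZ' P' hpf' R' S').hull) :=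
  cor38_ii_ofRankOnePoint hZ P hpf R S hZ' P' hpf' R' S' h (Toy.isDivSlim45iv_discretePUnit _)
    (Toy.isDivSlim45iv_discretePUnit _)

/-- **Cor. 3.8 (i) ∧ (ii) AS TYPED simultaneously for every such `h`.** [cite: MochizukiEtTh2009, Cor 3.8 p.80] -/
theorem cor38_i_ii_ofRankOnePoint
    (h : Cor38Hyp (ofRankOnePoint hZ P hpf R S) (ofRankOnePoint hZ' P' hpf' R' S')) :
    Literature.AnabelianGeometry.EtaleTheta.Cor38_i
        (fun E _ => Literature.AlgebraicGeometry.Frobenioids.IsFrobeniusSlim E) h ∧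
      Literature.AnabelianGeometry.EtaleTheta.Cor38_ii
        (fun E _ Φ => ∀ (A : E) (α : Aut (Over.forget A)),
          (∀ (B : Over A) (x : Φ.obj (op B.left)),
            Literature.AlgebraicGeometry.Frobenioids.pull Φ (α.hom.app B) x = x) → α = 1) h :=
  ⟨cor38_i_ofRankOnePoint hZ P hpf R S hZ' P' hpf' R' S' h, cor38_ii_ofRankOnePoint hZ P hpf R S hZ' P' hpf' R' S' h⟩

end RankOnePair

end TemperedFrobenioid

/-! ## §3 Instances BY NAME: the Tate tower (model of record) and the one-component model -/

namespace TateTowerFrd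

variable (R S R' S' : ((Discrete PUnit.{1})ᵒᵖ ⥤ CommMonCat.{0}) → Prop)

/-- **[EtTh] Cor. 3.8 (i) AS TYPED holds with NO binder beyond `h` at the MODEL OF RECORD** — abc-iut-w6-d048's tempered
Frobenioid `TateTowerFrd.temperedFrobenioid` of the Tate tower of abc-iut-w6-d058 (the `p`-adic Frobenioid of the base field of
the Tate curve at the bottom of its universal combinatorial covering). [cite: MochizukiEtTh2009, Cor 3.8 p.80] -/
theorem cor38_i_temperedFrobenioid (h : Cor38Hyp (temperedFrobenioid R S) (temperedFrobenioid R' S')) :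
    Literature.AnabelianGeometry.EtaleTheta.Cor38_i
      (fun E _ => Literature.AlgebraicGeometry.Frobenioids.IsFrobeniusSlim E) h :=
  TemperedFrobenioid.cor38_i_ofRankOnePoint _ _ _ R S _ _ _ R' S' h

/-- The CONCLUSION of [EtTh] Cor. 3.8 (i) at the model of record, for every `h`. [cite: MochizukiEtTh2009, Cor 3.8 p.80] -/
theorem preservesBaseFieldTheoretic_temperedFrobenioid
    (h : Cor38Hyp (temperedFrobenioid R S) (temperedFrobenioid R' S')) :
    Literature.AnabelianGeometry.EtaleTheta.PreservesBaseFieldTheoretic h :=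
  TemperedFrobenioid.preservesBaseFieldTheoretic_ofRankOnePoint _ _ _ R S _ _ _ R' S' h

/-- **[EtTh] Cor. 3.8 (ii) AS TYPED holds with NO binder beyond `h` at the MODEL OF RECORD.** [cite: MochizukiEtTh2009, Cor 3.8 p.81] -/
theorem cor38_ii_temperedFrobenioid (h : Cor38Hyp (temperedFrobenioid R S) (temperedFrobenioid R' S')) :
    Literature.AnabelianGeometry.EtaleTheta.Cor38_ii
      (fun E _ Φ => ∀ (A : E) (α : Aut (Over.forget A)),
        (∀ (B : Over A) (x : Φ.obj (op B.left)),
          Literature.AlgebraicGeometry.Frobenioids.pull Φ (α.hom.app B) x = x) → α = 1) h :=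
  TemperedFrobenioid.cor38_ii_ofRankOnePoint _ _ _ R S _ _ _ R' S' h

/-- The CONCLUSION of [EtTh] Cor. 3.8 (ii) at the model of record, for every `h`. [cite: MochizukiEtTh2009, Cor 3.8 p.81] -/
theorem cor38_ii_conclusion_temperedFrobenioid
    (h : Cor38Hyp (temperedFrobenioid R S) (temperedFrobenioid R' S')) :
    PreservesBaseFieldTheoretic h ∧
      ∃ Ψbs : (temperedFrobenioid R S).hullCategory ≌ (temperedFrobenioid R' S').hullCategory,
        Nonempty ((temperedFrobenioid R S).hull ⋙ h.Ψ.functor ≅ Ψbs.functor ⋙ (temperedFrobenioid R' S').hull) :=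
  TemperedFrobenioid.cor38_ii_conclusion_ofRankOnePoint _ _ _ R S _ _ _ R' S' h

end TateTowerFrd

namespace OneCompFrd

variable (U : Type) [CommGroup U] (hU : ∀ u : U, (∀ N : ℕ+, ∃ g : U, g ^ (N : ℕ) = u) → u = 1)
  (R S R' S' : ((Discrete PUnit.{1})ᵒᵖ ⥤ CommMonCat.{0}) → Prop)

/-- **[EtTh] Cor. 3.8 (i) AS TYPED with NO binder beyond `h` at the ONE-COMPONENT model** (smooth reduction, `G = 1`;
abc-iut-w6-d048's `OneCompFrd.temperedFrobenioidWeak`). [cite: MochizukiEtTh2009, Cor 3.8 p.80] -/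
theorem cor38_i_temperedFrobenioidWeak
    (h : Cor38Hyp (temperedFrobenioidWeak U hU R S) (temperedFrobenioidWeak U hU R' S')) :
    Literature.AnabelianGeometry.EtaleTheta.Cor38_i
      (fun E _ => Literature.AlgebraicGeometry.Frobenioids.IsFrobeniusSlim E) h :=
  TemperedFrobenioid.cor38_i_ofRankOnePoint _ _ _ R S _ _ _ R' S' h

/-- **[EtTh] Cor. 3.8 (ii) AS TYPED with NO binder beyond `h` at the one-component model.** [cite: MochizukiEtTh2009, Cor 3.8 p.81] -/
theorem cor38_ii_temperedFrobenioidWeak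
    (h : Cor38Hyp (temperedFrobenioidWeak U hU R S) (temperedFrobenioidWeak U hU R' S')) :
    Literature.AnabelianGeometry.EtaleTheta.Cor38_ii
      (fun E _ Φ => ∀ (A : E) (α : Aut (Over.forget A)),
        (∀ (B : Over A) (x : Φ.obj (op B.left)),
          Literature.AlgebraicGeometry.Frobenioids.pull Φ (α.hom.app B) x = x) → α = 1) h :=
  TemperedFrobenioid.cor38_ii_ofRankOnePoint _ _ _ R S _ _ _ R' S' h

end OneCompFrd

end Literature.AnabelianGeometry.EtaleTheta

end
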